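import Literature.Geometry.Kaehler.ComplexTorusLatticeMonomials
import HarnessLib

/-!
# Elementary integer matrices on a complex torus: moving one lattice coordinate onto every monomial

Companion of `ComplexTorusLatticeMonomials` (lattice monomials `dx_w`, the basis `latMonomialBasis Φ k` of
increasing ones, and the action `dx_w ∘ ρ(A)` of the homomorphisms `mapMatrix A`) and of
`ComplexTorusCoordForms` (the `k = 2` case `comp_realRep_elementary` used by the Kähler-torus barrier
files). For the complex torus `X = E/Φ(ℤ^ι)` (Lange–Birkenhake (1992), §1.1.2 rational/analytic
representations, §1.1.4 Prop. 1.1.20):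

* `latMonomialBasis_repr_apply` — **coordinates in the lattice-monomial basis are the values on the
  increasing lattice tuples**, `a = Σ_{w↑} a(Φe_w) dx_w`; hence `eq_of_apply_single_eq`: an invariant
  form is determined by these values;
* `cmap_cconstClass_mapMatrix₂` — the two-tori form of `cmap_cconstClass_mapMatrix`: for tori
  `E/Φ(ℤ^ι)`, `E/Φ'(ℤ^ι')` on the SAME model space and `A ∈ M(ι' × ι, ℤ)`,
  `(mapMatrix A)^*[c] = [c ∘ ρ(A)]` on complex de Rham classes;
* `elemMatrix w u` — the **elementary integer matrix** `B(w,u)` of two words (`B e_{u j} = e_{w j}`,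
  other columns `0`) and **`comp_realRep_elemMatrix`**: for `u` increasing,
  `γ ∘ ρ(B(w,u)) = γ(Φe_w) · dx_u` for EVERY invariant `k`-form `γ` — the rank-`k` homomorphisms move
  the `w`-coordinate of `γ` onto the monomial `dx_u` and kill the others (both sides agree on all
  increasing lattice tuples). This is the all-degree version of the device by which a single non-zero
  rational class produces rational multiples of every lattice monomial
  (`Literature.AlgebraicGeometry.HodgeTheory.RationallyNormalisedDeRhamFamily`).

## References

* H. Lange, Ch. Birkenhake, *Complex Abelian Varieties* (1992), §1.1.2, §1.1.4 Prop. 1.1.20.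
  [LangeBirkenhake1992]
-/

noncomputable section

open scoped Manifold ContDiff
open ContinuousAlternatingMap Function
open Literature.NumberTheory.Transcendental Literature.LinearAlgebra.Alternating

namespace Literature.Geometry.Kaehler

namespace ComplexTorus

/-! ### Coordinates in the lattice-monomial basis; pull-back between two tori -/

variable {ι : Type} [Fintype ι] [LinearOrder ι] {E : Type} [NormedAddCommGroup E] [NormedSpace ℂ E]
  (Φ : (ι → ℝ) ≃L[ℝ] E) {k : ℕ}

/-- **Coordinates in the lattice-monomial basis are values on increasing lattice tuples**:
`(latMonomialBasis Φ k).repr a w = a(Φ e_{w 0}, …, Φ e_{w (k-1)})` for `w` strictly increasing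
(the `dx_w` are dual to the increasing lattice tuples, `frameWord_apply_comp_strictMono`).
[cite: LangeBirkenhake1992, §1.1.4 Prop. 1.1.20] -/
theorem latMonomialBasis_repr_apply (a : E [⋀^Fin k]→L[ℝ] ℂ) (w : {w : Fin k → ι // StrictMono w}) :
    (latMonomialBasis Φ k).repr a w = a (fun i ↦ Φ (Pi.single (w.1 i) 1)) := by
  classical
  conv_rhs => rw [← (latMonomialBasis Φ k).sum_repr a]
  rw [ContinuousAlternatingMap.sum_apply, Finset.sum_eq_single w]
  · rw [ContinuousAlternatingMap.smul_apply, latMonomialBasis_apply, latMonomial,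
      show (fun i ↦ Φ (Pi.single (w.1 i) (1 : ℝ))) = (fun a ↦ Φ (Pi.single a 1)) ∘ w.1 from rfl,
      frameWord_apply_comp_strictMono (coord Φ) (fun a ↦ Φ (Pi.single a 1)) (coord_dual Φ) w.2 w.2,
      if_pos rfl, smul_eq_mul, mul_one]
  · intro w' _ hw'
    rw [ContinuousAlternatingMap.smul_apply, latMonomialBasis_apply, latMonomial,
      show (fun i ↦ Φ (Pi.single (w.1 i) (1 : ℝ))) = (fun a ↦ Φ (Pi.single a 1)) ∘ w.1 from rfl,
      frameWord_apply_comp_strictMono (coord Φ) (fun a ↦ Φ (Pi.single a 1)) (coord_dual Φ) w'.2 w.2,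
      if_neg (fun h ↦ hw' (Subtype.ext h)), smul_zero]
  · intro h
    exact absurd (Finset.mem_univ w) h

/-- **An invariant form is determined by its values on the increasing lattice tuples.**
[cite: LangeBirkenhake1992, §1.1.4 Prop. 1.1.20] -/
theorem eq_of_apply_single_eq {a b : E [⋀^Fin k]→L[ℝ] ℂ}
    (h : ∀ w : {w : Fin k → ι // StrictMono w},
      a (fun i ↦ Φ (Pi.single (w.1 i) 1)) = b (fun i ↦ Φ (Pi.single (w.1 i) 1))) : a = b := by
  refine (latMonomialBasis Φ k).repr.injective (Finsupp.ext fun w ↦ ?_)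
  rw [latMonomialBasis_repr_apply, latMonomialBasis_repr_apply, h w]

variable {ι' : Type} [Fintype ι'] (Φ' : (ι' → ℝ) ≃L[ℝ] E)

omit [LinearOrder ι] in
/-- **Pull-back of the class of an invariant form between two tori on the same model space**:
`(mapMatrix A)^*[c] = [c ∘ ρ(A)]` for `A ∈ M(ι' × ι, ℤ)`, `ρ(A) = Φ' A_ℝ Φ⁻¹ : E → E`
(two-tori form of `cmap_cconstClass_mapMatrix`). [cite: LangeBirkenhake1992, §1.1.4] -/
theorem cmap_cconstClass_mapMatrix₂ (A : Matrix ι' ι ℤ) (c : E [⋀^Fin k]→L[ℝ] ℂ) :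
    complexDeRhamCohomology.map E (contMDiff_real_mapMatrix (Φ := Φ) (Φ' := Φ') (n := ∞) A) k
        (cconstClass Φ' c) =
      cconstClass Φ (c.compContinuousLinearMap (realRep Φ Φ' A)) := by
  rw [cconstClass_apply, complexDeRhamCohomology.map_mk, cconstClass_apply]
  congr 1
  exact Subtype.ext (pullback_constForm_mapMatrix (Φ := Φ) (Φ' := Φ') A c)


/-! ### Elementary integer matrices move one coordinate onto every lattice monomial -/

/-- **The elementary integer matrix** `B(w, u)` of two words: `B e_{u j} = e_{w j}` and `B e_c = 0`
for `c` not a letter of `u` (for `u` injective): entries `B_{rc} = #{j : r = w j ∧ c = u j}`.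
The rank-`k` matrices of Lange–Birkenhake's rational representation used to move coordinates.
[cite: LangeBirkenhake1992, §1.1.2] -/
def elemMatrix (w u : Fin k → ι) : Matrix ι ι ℤ :=
  Matrix.of fun r c ↦ ∑ j : Fin k, if r = w j ∧ c = u j then 1 else 0

/-- Column `u j` of `B(w, u)` is `e_{w j}` (`u` injective). [cite: LangeBirkenhake1992, §1.1.2] -/
theorem elemMatrix_mulVec_single {w u : Fin k → ι} (hu : Injective u) (j : Fin k) :
    ((elemMatrix w u).map (Int.cast : ℤ → ℝ)).mulVec (Pi.single (u j) 1) = Pi.single (w j) 1 := by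
  rw [Matrix.mulVec_single_one]
  funext r
  simp only [Matrix.col_apply, Matrix.map_apply, elemMatrix, Matrix.of_apply, hu.eq_iff]
  rw [Finset.sum_eq_single j]
  · by_cases h : r = w j
    · subst h; simp
    · rw [if_neg (fun h' ↦ h h'.1), Pi.single_apply, if_neg h, Int.cast_zero]
  · intro j' _ hj'
    exact if_neg fun h' ↦ hj' (h'.2.symm)
  · intro h
    exact absurd (Finset.mem_univ j) h

/-- Column `c` of `B(w, u)` vanishes when `c` is not a letter of `u`. [cite: LangeBirkenhake1992, §1.1.2] -/
theorem elemMatrix_mulVec_single_of_notMem {w u : Fin k → ι} {c : ι} (hc : c ∉ Set.range u) :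
    ((elemMatrix w u).map (Int.cast : ℤ → ℝ)).mulVec (Pi.single c 1) = 0 := by
  rw [Matrix.mulVec_single_one]
  funext r
  simp only [Matrix.col_apply, Matrix.map_apply, elemMatrix, Matrix.of_apply, Pi.zero_apply]
  rw [Finset.sum_eq_zero fun j _ ↦ if_neg fun h ↦ hc ⟨j, h.2.symm⟩, Int.cast_zero]

/-- `ρ(B(w,u)) (Φ e_{u j}) = Φ e_{w j}`. [cite: LangeBirkenhake1992, §1.1.2] -/
theorem realRep_elemMatrix_single {w u : Fin k → ι} (hu : Injective u) (j : Fin k) :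
    realRep Φ Φ (elemMatrix w u) (Φ (Pi.single (u j) 1)) = Φ (Pi.single (w j) 1) := by
  rw [realRep_apply, elemMatrix_mulVec_single hu j]

/-- `ρ(B(w,u)) (Φ e_c) = 0` for `c` not a letter of `u`. [cite: LangeBirkenhake1992, §1.1.2] -/
theorem realRep_elemMatrix_single_of_notMem {w u : Fin k → ι} {c : ι} (hc : c ∉ Set.range u) :
    realRep Φ Φ (elemMatrix w u) (Φ (Pi.single c 1)) = 0 := by
  rw [realRep_apply, elemMatrix_mulVec_single_of_notMem hc, _root_.map_zero]

omit [Fintype ι] in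
/-- Two different increasing words of the same length: some letter of the second is not a letter of
the first. [folklore] -/
theorem exists_apply_notMem_range {w v : Fin k → ι} (hw : StrictMono w) (hv : StrictMono v)
    (h : w ≠ v) : ∃ i, v i ∉ Set.range w := by
  by_contra hcon
  have hsub : Set.range v ⊆ Set.range w := by
    rintro _ ⟨i, rfl⟩
    by_contra hi
    exact hcon ⟨i, hi⟩
  have heq : Set.range v = Set.range w :=
    Set.eq_of_subset_of_ncard_le hsub (by
      rw [Set.ncard_range_of_injective hw.injective, Set.ncard_range_of_injective hv.injective])
  exact h ((hw.range_inj hv).1 heq.symm)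

/-- **The elementary computation**: for increasing words `w, u` and any invariant form `γ`,
`γ ∘ ρ(B(w, u)) = γ(Φ e_w) · dx_u` — the integer matrix `B(w,u)` moves the `w`-coordinate of `γ`
onto the monomial `dx_u` and kills all other coordinates (both sides agree on every increasing
lattice tuple). [cite: LangeBirkenhake1992, §1.1.2 and §1.1.4] -/
theorem comp_realRep_elemMatrix (γ : E [⋀^Fin k]→L[ℝ] ℂ) (w : Fin k → ι) {u : Fin k → ι}
    (hu : StrictMono u) :
    γ.compContinuousLinearMap (realRep Φ Φ (elemMatrix w u)) =
      γ (fun i ↦ Φ (Pi.single (w i) 1)) • latMonomial Φ k u := by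
  refine eq_of_apply_single_eq Φ fun v ↦ ?_
  have hval : latMonomial Φ k u (fun i ↦ Φ (Pi.single (v.1 i) 1)) = if u = v.1 then (1 : ℂ) else 0 :=
    frameWord_apply_comp_strictMono (coord Φ) (fun a ↦ Φ (Pi.single a 1)) (coord_dual Φ) hu v.2
  rw [compContinuousLinearMap_apply, ContinuousAlternatingMap.smul_apply, hval]
  by_cases huv : u = v.1
  · rw [if_pos huv, smul_eq_mul, mul_one]
    congr 1
    funext i
    rw [comp_apply, ← huv]
    exact realRep_elemMatrix_single Φ hu.injective i
  · rw [if_neg huv, smul_zero]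
    obtain ⟨i, hi⟩ := exists_apply_notMem_range hu v.2 huv
    exact γ.map_coord_zero i (realRep_elemMatrix_single_of_notMem Φ hi)

end ComplexTorus

end Literature.Geometry.Kaehler

end
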